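import Summits.Ventures.CertifiedManyBodySolver.Rows.CorrWindowCertKernelPoly
import Summits.Ventures.CertifiedQuantumChemistry.Rows.SOSDualMerge
import HarnessLib

/-!
# The STAGED (chunked) kernel replay of a window certificate: ENCODED MERGE CHAIN + SLICED RESIDUAL
# (item (v′) of HOME/hubbard-obs-p2/TIER-P-SIZING-g22-ADDENDUM §9)

HONEST FRAMING: Lean plumbing towards «tier P» (an SDP window certificate of the La214 programs becoming a kernel theorem).
MEASURED by seat g22 (HOME/STATUS «MEASUREMENT + CAVEAT TO (C) ITEM (iv)» 21:21:40Z): ONE `decide +kernel` declaration holds a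
normal form of at most ≈ 10⁴ monomials on the farm's 12-GB build lane, so no real certificate passes through
`affineOrbitLowerRowN_of_kernelCert{,G,TB}` in one call. This file is the STAGED edition: the residual term list is cut into
SLICES (`residTGslices`, per-pair Gram slices `gramTBslices`, regrouped to any sizes by `groupSlices`), each slice is normal-ordered
by ONE kernel declaration and merged into an ENCODED accumulator (`stepE` = the quantum-chemistry cell's `SOSDual.mergeE` step of
`CertifiedQuantumChemistry/Rows/SOSDualMerge.lean`, which carried their Hubbard-ring `L = 10` DQG certificates), the per-step kernel
facts are collected in `ChainOK`, and `evalPoly_chain` says the last accumulator DENOTES the residual — exactly the semantic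
hypothesis `hRsem` of `affineOrbitLowerRowN_of_residPolyG` (`Rows/CorrWindowCertKernelPoly.lean`). The closers
`affineOrbitLowerRowN_of_chainKernelCertG/TB` therefore turn «chain facts + ONE rational inequality on the last accumulator» into
the affine-N claim-node predicate. Nothing of record moves; no claim node is discharged here; the rows this serves are
CONTROL/CALIBRATION stiffness-scale CEILINGS (wording (xx1)), silent on the presence of superconductivity; not a `T_c` or phase
sentence; nothing about any material; no summit statement is proved by this file. Seat hubbard-obs-p2 (STIFFNESS),
`prover-hubbard-obs-p2-g23-0`, zero compute.

THE OBJECTS (letters `Orb (Fin N)`, the quantum-chemistry cell's coded letters `SOSDual.encL`, sort base `B`):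
* `stepE B C T := SOSDual.mergeE B C (SOSDual.encPoly (CARPoly.normalize SOSDual.encL B T))` — one accumulation step (the cell's
  inline step, named); `evalPoly_stepE`: `decPoly N (stepE B C T)` denotes `decPoly N C + termOp d T` for every INJECTIVE letter map
  `d` (the cell's soundness lemmas `evalPoly_decPoly_{emitE,mergeAdjE,mergeE}` are stated for the identity letter map; §1 re-proves
  them `d`-generically, same 40 lines);
* `ChainOK B M Cs Ts` (fields `len : Ts.length = M`, `step : ∀ i : Fin M, Cs.getD (i+1) [] = stepE B (Cs.getD i []) (Ts.getD i [])`) — the per-step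
  KERNEL FACTS of an instance file (accumulators `Cs` = `eval%` literals, one `decide +kernel` per step, assembled by the `Fin M`
  pattern-match idiom of `CertifiedQuantumChemistry/Certificates/HubbardRingL10U10055DQGKernelLower.lean`); `evalPoly_chain`:
  `decPoly N (Cs.getD M [])` denotes `decPoly N (Cs.getD 0 []) + termOp d Ts.flatten`;
* `residTGslices … TGs …` — the residual of `Rows/CorrWindowCertKernelFormGram.lean` cut into slices (head slice = objective +
  density + energy rows; one slice per Gram slice of `TGs`, per eom generator, per symmetry identification; charged words;
  anti-Hermitian parts) with the LIST identity `flatten_residTGslices : (residTGslices … TGs …).flatten = residTG … TGs.flatten …`;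
  `gramTBslices K blocks` — the two-level Gram list one slice per (block, i, j) (`|vᵢ|·|vⱼ|` products each) with
  `flatten_gramTBslices : (gramTBslices K blocks).flatten = gramTB K blocks` (so PSD-by-construction survives slicing);
  `groupSlices Ts ns` — consecutive regrouping to exporter-chosen sizes (`SOSDual.slicesFrom`), `flatten_groupSlices`;
* `affineOrbitLowerRowN_of_chainKernelCertG` (abstract Gram slices `TGs` with `termOp d TGs.flatten = gramForm Λ O`, `Λ ⪰ 0`) and
  `affineOrbitLowerRowN_of_chainKernelCertTB` (two-level Gram `blocks`, no positivity obligation): data of `…kernelCertTB` +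
  `(ns) (M) (Cs) (hC0 : Cs.getD 0 [] = []) (hchain : ChainOK B M Cs (groupSlices (residTGslices …) ns))` +
  `hq : q ≤ lowerConst (decPoly N (Cs.getD M [])) + (μ 0 + μ 1)(n₀/2 − ν)` ⇒
  `SquareTTPrimeCorrAffineOrbitLowerRowN tp U q hi lo κhi κlo s n₀ S Λ' (termOp d TX)`.
An uncollected or partially merged accumulator only weakens `lowerConst`, never soundness (`affineOrbitLowerRowN_of_residPolyG`).
STEP-0 instance: `Certificates/HubbardSquare_tpm3o10_U29o5_toyKernelCert_pauliRowTBChain.lean`.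

References: J. Wang et al., PRX 14 (2024) 031006 §III [WangEtAl2024]; X. Han, arXiv:2006.06002 §2–§3 [Han2020Bootstrap]; C. Jansson,
D. Chaykin, C. Keil, SIAM J. Numer. Anal. 46 (2008) 180 [JanssonChaykinKeil2008]; O. Bratteli, D. W. Robinson, *Operator Algebras and
Quantum Statistical Mechanics 2* §5.2.2 [BratteliRobinsonII1997].
-/

namespace Summit.Ventures.CertifiedManyBodySolver

namespace CARPolyWindow

open Summit.Ventures.CertifiedQuantumChemistry Summit.Ventures.CertifiedQuantumChemistry.CARPoly
open Literature.MathematicalPhysics.QuantumLattice Literature.MathematicalPhysics.QuantumLattice.HubbardWave0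
open Literature.MathematicalPhysics.QuantumManyBody.StateRelaxation
open Literature.Probability.LatticeModels ThermodynamicLimit Filter Topology
open Matrix
open scoped ComplexOrder BigOperators

/-! ## §1 One encoded accumulation step and its `d`-generic soundness -/

section Step

variable {N : ℕ}

/-- **One accumulation step of the encoded merge chain**: merge the accumulator `C` with the encoded collected normal form of the
slice `T` (the quantum-chemistry cell's inline chain step `mergeE B C (encPoly (normalize encL B T))`, named). Computable; this is
what an instance's `eval%` literals and per-step `decide +kernel` facts mention. [cite: JanssonChaykinKeil2008, §3] -/
def stepE (B : ℕ) (C : SOSDual.EncPoly) (T : Terms (Orb (Fin N))) : SOSDual.EncPoly :=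
  SOSDual.mergeE B C (SOSDual.encPoly (CARPoly.normalize SOSDual.encL B T))

variable [NeZero N] {ι : Type*} [LinearOrder ι] [Fintype ι]

/-- `emitE` is sound for every letter map (the cell's `evalPoly_decPoly_emitE`, `d`-generic). [cite: BratteliRobinsonII1997, §5.2.2] -/
theorem evalPoly_decPoly_emitE' (d : Orb (Fin N) → ι) (m : SOSDual.EMono) (c : ℤ × ℕ) (rest : SOSDual.EncPoly) :
    evalPoly d (SOSDual.decPoly N (SOSDual.emitE m c rest)) =
      ((SOSDual.qOf c : ℚ) : ℂ) • evalMono d (SOSDual.decM N m) + evalPoly d (SOSDual.decPoly N rest) := by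
  unfold SOSDual.emitE
  split_ifs with h
  · have : SOSDual.qOf c = 0 := by simp [SOSDual.qOf, h]
    rw [this, Rat.cast_zero, zero_smul, zero_add]
  · rw [SOSDual.decPoly_cons, evalPoly_cons]

/-- `mergeAdjE` is sound for every letter map (the cell's `evalPoly_decPoly_mergeAdjE`, `d`-generic). [cite: BratteliRobinsonII1997, §5.2.2] -/
theorem evalPoly_decPoly_mergeAdjE' (d : Orb (Fin N) → ι) : ∀ (m : SOSDual.EMono) (c : ℤ × ℕ) (E : SOSDual.EncPoly),
    evalPoly d (SOSDual.decPoly N (SOSDual.mergeAdjE m c E)) =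
      ((SOSDual.qOf c : ℚ) : ℂ) • evalMono d (SOSDual.decM N m) + evalPoly d (SOSDual.decPoly N E)
  | m, c, [] => by rw [SOSDual.mergeAdjE, evalPoly_decPoly_emitE']
  | m, c, mc :: rest => by
    rw [SOSDual.mergeAdjE]
    split_ifs with h
    · rw [evalPoly_decPoly_mergeAdjE' d m (SOSDual.addE c mc.2) rest, SOSDual.qOf_addE, SOSDual.decPoly_cons, evalPoly_cons, h,
        Rat.cast_add, add_smul, add_assoc]
    · rw [evalPoly_decPoly_emitE', evalPoly_decPoly_mergeAdjE' d mc.1 mc.2 rest, SOSDual.decPoly_cons, evalPoly_cons]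

/-- **`mergeE` is sound for every letter map**: the merge denotes the sum (the cell's `evalPoly_decPoly_mergeE`, `d`-generic: a
permutation + merging equal adjacent monomials + dropping zeros; no property of the key or of sortedness is used).
[cite: BratteliRobinsonII1997, §5.2.2] -/
theorem evalPoly_decPoly_mergeE' (d : Orb (Fin N) → ι) (B : ℕ) (C E : SOSDual.EncPoly) :
    evalPoly d (SOSDual.decPoly N (SOSDual.mergeE B C E)) =
      evalPoly d (SOSDual.decPoly N C) + evalPoly d (SOSDual.decPoly N E) := by
  have hperm : (SOSDual.decPoly N ((mergeByKey (C.map fun mc => (SOSDual.keyE B mc.1, mc))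
      (E.map fun mc => (SOSDual.keyE B mc.1, mc))).map Prod.snd)).Perm (SOSDual.decPoly N (C ++ E)) := by
    rw [SOSDual.decPoly_eq_map, SOSDual.decPoly_eq_map]
    exact (SOSDual.map_snd_mergeByKey_perm B C E).map _
  rw [← evalPoly_append, ← SOSDual.decPoly_append, ← evalPoly_perm d hperm]
  unfold SOSDual.mergeE
  cases hL : (mergeByKey (C.map fun mc => (SOSDual.keyE B mc.1, mc)) (E.map fun mc => (SOSDual.keyE B mc.1, mc))).map
      Prod.snd with
  | nil => rfl
  | cons mc rest => rw [evalPoly_decPoly_mergeAdjE', SOSDual.decPoly_cons, evalPoly_cons]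

/-- **Soundness of one step**: for an injective letter map `d`, `decPoly N (stepE B C T)` denotes `decPoly N C + termOp d T`.
[cite: BratteliRobinsonII1997, §5.2.2] [cite: JanssonChaykinKeil2008, §3] -/
theorem evalPoly_stepE {d : Orb (Fin N) → ι} (hd : Function.Injective d) (B : ℕ) (C : SOSDual.EncPoly) (T : Terms (Orb (Fin N))) :
    evalPoly d (SOSDual.decPoly N (stepE B C T)) = evalPoly d (SOSDual.decPoly N C) + termOp d T := by
  rw [stepE, evalPoly_decPoly_mergeE', SOSDual.decPoly_encPoly, evalPoly_normalize' hd]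

/-- The empty accumulator denotes `0`. [folklore] -/
@[simp] theorem evalPoly_decPoly_nil (d : Orb (Fin N) → ι) : evalPoly d (SOSDual.decPoly N ([] : SOSDual.EncPoly)) = 0 := rfl

end Step

/-! ## §2 Chains of step facts -/

section Chain

variable {N : ℕ}

/-- **The per-step kernel facts of a staged replay**: `Ts` has exactly `M` slices and, for every `i < M`, accumulator `i+1` IS the
step of accumulator `i` with slice `i` (out-of-range reads default to `[]`; in an instance file every conjunct is one
`decide +kernel` declaration on `eval%` literals, assembled by pattern matching on `Fin M`). [cite: JanssonChaykinKeil2008, §3] -/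
structure ChainOK (B M : ℕ) (Cs : List SOSDual.EncPoly) (Ts : List (Terms (Orb (Fin N)))) : Prop where
  /-- the slice list has exactly `M` entries -/
  len : Ts.length = M
  /-- step `i`: accumulator `i+1` is the encoded merge step of accumulator `i` with slice `i` -/
  step : ∀ i : Fin M, Cs.getD (i.val + 1) [] = stepE B (Cs.getD i.val []) (Ts.getD i.val [])

variable [NeZero N] {ι : Type*} [LinearOrder ι] [Fintype ι]

/-- The chain invariant after `n ≤ M` steps: accumulator `n` denotes accumulator `0` plus the first `n` slices. [folklore] -/
theorem evalPoly_chain_take {d : Orb (Fin N) → ι} (hd : Function.Injective d) {B M : ℕ} {Cs : List SOSDual.EncPoly}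
    {Ts : List (Terms (Orb (Fin N)))} (h : ChainOK B M Cs Ts) :
    ∀ n, n ≤ M → evalPoly d (SOSDual.decPoly N (Cs.getD n [])) =
      evalPoly d (SOSDual.decPoly N (Cs.getD 0 [])) + termOp d (Ts.take n).flatten
  | 0, _ => by rw [List.take_zero, List.flatten_nil, termOp_nil, add_zero]
  | n + 1, hn => by
    have hlt : n < Ts.length := by rw [h.len]; omega
    rw [h.step ⟨n, by omega⟩, evalPoly_stepE hd, evalPoly_chain_take hd h n (by omega), List.take_succ_eq_append_getElem hlt,
      List.flatten_append, List.flatten_singleton, termOp_append, List.getD_eq_getElem _ _ hlt, add_assoc]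

/-- **Soundness of a chain**: the last accumulator denotes the first one plus ALL slices. [cite: JanssonChaykinKeil2008, §3] -/
theorem evalPoly_chain {d : Orb (Fin N) → ι} (hd : Function.Injective d) {B M : ℕ} {Cs : List SOSDual.EncPoly}
    {Ts : List (Terms (Orb (Fin N)))} (h : ChainOK B M Cs Ts) :
    evalPoly d (SOSDual.decPoly N (Cs.getD M [])) = evalPoly d (SOSDual.decPoly N (Cs.getD 0 [])) + termOp d Ts.flatten := by
  have e := evalPoly_chain_take hd h M le_rfl
  rwa [List.take_of_length_le h.len.le] at e

/-- A chain from the EMPTY accumulator: the last accumulator denotes exactly `termOp d Ts.flatten`. [cite: JanssonChaykinKeil2008, §3] -/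
theorem evalPoly_chain_nil {d : Orb (Fin N) → ι} (hd : Function.Injective d) {B M : ℕ} {Cs : List SOSDual.EncPoly}
    {Ts : List (Terms (Orb (Fin N)))} (hC0 : Cs.getD 0 [] = []) (h : ChainOK B M Cs Ts) :
    evalPoly d (SOSDual.decPoly N (Cs.getD M [])) = termOp d Ts.flatten := by
  rw [evalPoly_chain hd h, hC0, evalPoly_decPoly_nil, zero_add]

end Chain

/-! ## §3 Slicing the residual (list identities only; no evaluation) -/

section Slices

variable {α β : Type*}

/-- `negT` distributes over concatenation. [folklore] -/
theorem negT_append (A B : Terms α) : negT (A ++ B) = negT A ++ negT B := List.map_append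

/-- `negT` of a flattened family is the flattened family of `negT`s. [folklore] -/
theorem negT_flatten (L : List (Terms α)) : negT L.flatten = (L.map negT).flatten := by
  induction L with
  | nil => rfl
  | cons T L ih => rw [List.flatten_cons, negT_append, ih, List.map_cons, List.flatten_cons]

/-- A flattened `map` is a `flatMap`. [folklore] -/
theorem flatten_map_eq_flatMap {γ δ : Type*} (L : List γ) (F : γ → List δ) : (L.map F).flatten = L.flatMap F := by
  induction L with
  | nil => rfl
  | cons x L ih => rw [List.map_cons, List.flatten_cons, ih, List.flatMap_cons]

/-- `negT` of a `flatMap` is the flattened family of the negated pieces. [folklore] -/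
theorem negT_flatMap {γ : Type*} (L : List γ) (F : γ → Terms α) :
    negT (L.flatMap F) = (L.map fun x => negT (F x)).flatten := by
  rw [← flatten_map_eq_flatMap, negT_flatten, List.map_map]
  rfl

/-- Flattening a `flatMap` of families. [folklore] -/
theorem flatten_flatMap' {γ δ : Type*} (L : List γ) (G : γ → List (List δ)) :
    (L.flatMap G).flatten = L.flatMap fun x => (G x).flatten := by
  induction L with
  | nil => rfl
  | cons x L ih => rw [List.flatMap_cons, List.flatten_append, ih, List.flatMap_cons]

/-- The HEAD slice: objective minus density rows minus energy rows (no products; cheap). [cite: WangEtAl2024, §III] -/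
def headSliceT (TX : Terms α) (μ : Fin 2 → ℚ) (ν : ℚ) (o : Fin 2 → α) (κhi hi κlo lo : ℚ) (TE : Terms α) : Terms α :=
  TX ++ negT ((finL 2).flatMap fun σ => scaleT (μ σ) (densT o ν σ))
    ++ negT (scaleT κhi (unitT hi ++ negT TE)) ++ negT (scaleT κlo (TE ++ unitT (-lo)))

/-- **The SLICED residual**: `[head] ++ (−Gram slices) ++ (−[H, Γ Bₖ] per generator) ++ (−(Γ(γₗ·Yₗ+vₗ) − Γ Yₗ) per identification)
++ [−charged words, −anti-Hermitian parts]`. The exporter pre-slices the Gram family (`TGs`) and, if needed, regroups with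
`groupSlices`. [cite: WangEtAl2024, §III] [cite: Han2020Bootstrap, §3] -/
def residTGslices (TX : Terms α) (μ : Fin 2 → ℚ) (ν : ℚ) (o : Fin 2 → α) (κhi hi κlo lo : ℚ) (TE : Terms α)
    (TGs : List (Terms α)) (TH : Terms α) (f : β → α) (EB : List (Terms β))
    {nS : ℕ} (g : Fin nS → β → α) (SY : Fin nS → Terms β) (CW : Terms α) (AV : List (Terms α)) : List (Terms α) :=
  [headSliceT TX μ ν o κhi hi κlo lo TE] ++ TGs.map negT ++ EB.map (fun B => negT (commT TH (wmapT f B)))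
    ++ (finL nS).map (fun l => negT (wmapT (g l) (SY l) ++ negT (wmapT f (SY l)))) ++ [negT CW, negT (ahT AV)]

/-- **LIST IDENTITY: the slices re-assemble the residual** with Gram list `TGs.flatten` (pure rewriting: `negT` distributes over
`++` / `flatMap`). [cite: WangEtAl2024, §III] -/
theorem flatten_residTGslices (TX : Terms α) (μ : Fin 2 → ℚ) (ν : ℚ) (o : Fin 2 → α) (κhi hi κlo lo : ℚ) (TE : Terms α)
    (TGs : List (Terms α)) (TH : Terms α) (f : β → α) (EB : List (Terms β))
    {nS : ℕ} (g : Fin nS → β → α) (SY : Fin nS → Terms β) (CW : Terms α) (AV : List (Terms α)) :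
    (residTGslices TX μ ν o κhi hi κlo lo TE TGs TH f EB g SY CW AV).flatten =
      residTG TX μ ν o κhi hi κlo lo TE TGs.flatten TH f EB g SY CW AV := by
  rw [residTGslices, residTG, eomTβ, symT, negT_flatMap EB, negT_flatMap (finL nS), negT_flatten, List.flatten_append,
    List.flatten_append, List.flatten_append, List.flatten_append, List.flatten_singleton, headSliceT]
  simp only [List.flatten_cons, List.flatten_nil, List.append_nil, List.append_assoc]

/-- The two-level Gram list of ONE block, one slice per pair `(i, j)`: `((rᵢ · rⱼ)/4^K) · vᵢ† vⱼ`. [cite: Han2020Bootstrap, §2 eq. (2)] -/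
def gramTB1slices (K : ℕ) (RV : List (List ℤ × Terms α)) : List (Terms α) :=
  RV.flatMap fun a => RV.map fun b => scaleT ((idot a.1 b.1 : ℚ) / 4 ^ K) (mulT (daggerT a.2) b.2)

/-- **The SLICED two-level Gram list**: one slice per (block, i, j). [cite: WangEtAl2024, §III] -/
def gramTBslices (K : ℕ) (blocks : List (List (List ℤ × Terms α))) : List (Terms α) := blocks.flatMap (gramTB1slices K)

/-- One block's slices re-assemble the block. [cite: Han2020Bootstrap, §2 eq. (2)] -/
theorem flatten_gramTB1slices (K : ℕ) (RV : List (List ℤ × Terms α)) : (gramTB1slices K RV).flatten = gramTB1 K RV := by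
  rw [gramTB1slices, gramTB1, flatten_flatMap']
  refine List.flatMap_congr ?_   -- pointwise: (RV.map _).flatten = RV.flatMap _
  intro a _
  exact flatten_map_eq_flatMap RV _

/-- **LIST IDENTITY: the Gram slices re-assemble `gramTB K blocks`** (so `termOp_gramTB_eq_gramForm` and `gramTBCoef_posSemidef` apply to
the sliced list: PSD by construction survives slicing). [cite: WangEtAl2024, §III] -/
theorem flatten_gramTBslices (K : ℕ) (blocks : List (List (List ℤ × Terms α))) :
    (gramTBslices K blocks).flatten = gramTB K blocks := by
  rw [gramTBslices, gramTB, flatten_flatMap']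
  exact List.flatMap_congr fun RV _ => flatten_gramTB1slices K RV

/-- **Regrouping**: consecutive slices merged to the sizes `ns` (clipped; the remainder is the last group) — the exporter's knob
for «≤ 10⁴ raw products per kernel declaration». [cite: JanssonChaykinKeil2008, §3] -/
def groupSlices (Ts : List (Terms α)) (ns : List ℕ) : List (Terms α) := (SOSDual.slicesFrom Ts ns).map List.flatten

/-- Regrouping does not change the flattened list. [folklore] -/
theorem flatten_groupSlices (Ts : List (Terms α)) (ns : List ℕ) : (groupSlices Ts ns).flatten = Ts.flatten := by
  rw [groupSlices, ← List.flatten_flatten, SOSDual.flatten_slicesFrom]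

end Slices

/-! ## §4 The closers: chain facts + ONE rational inequality ⇒ the affine-N claim-node predicate -/

noncomputable section KernelChain

variable {β : Type*} {N : ℕ} [NeZero N]

/-- **STAGED KERNEL FORM, ABSTRACT GRAM SLICES: a merge chain over the regrouped sliced residual (Gram slices `TGs` denoting a
`gramForm Λ O` with `Λ ⪰ 0`), started from the empty accumulator, + `q ≤ lowerConst (decPoly N C_M) + (Σμ)(n₀/2 − ν)` ⇒
`SquareTTPrimeCorrAffineOrbitLowerRowN tp U q hi lo κhi κlo s n₀ S Λ' (termOp d TX)`.** [cite: WangEtAl2024, §III]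
[cite: JanssonChaykinKeil2008, §3] -/
theorem affineOrbitLowerRowN_of_chainKernelCertG
    (tp U : ℚ) (hU : 0 ≤ U)
    {Λ Λ' : Finset (Site 2)} (hΛ : Λ ⊆ Λ') (h8 : thicken Λ 1 ⊆ Λ')
    (h0 : thicken ({0} : Finset (Site 2)) 1 ⊆ Λ') (hz : (0 : Site 2) ∈ Λ')
    {S : Finset (DihedralGroup 4)} (h1 : (1 : DihedralGroup 4) ∈ S) (hmul : ∀ a ∈ S, ∀ b ∈ S, a * b ∈ S)
    -- letters
    (d : Orb (Fin N) → Orb (PolySite Λ')) (hd : Function.Injective d) (Bkey : ℕ)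
    (dΛ : β → Orb (PolySite Λ)) (f : β → Orb (Fin N)) (hf : ∀ b, d (f b) = Orb.embMap (PolySite.incl hΛ) (dΛ b))
    (sp : Orb (Fin N) → Fin 2) (hsp : ∀ a, (ofLex (d a)).2 = sp a)
    -- dictionaries
    (TH : Terms (Orb (Fin N))) (hH : termOp d TH = (hubbardTTPrimeFermionInteraction 1 tp U).localHamiltonian Λ')
    (TE : Terms (Orb (Fin N)))
    (hE : termOp d TE = fermionEmbed (PolySite.incl h0) ((hubbardTTPrimeFermionInteraction 1 tp U).meanEnergyObs 1))
    (o : Fin 2 → Orb (Fin N)) (ho : ∀ σ, d (o σ) = orb (PolySite.pt 0 hz) σ)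
    -- certificate data
    (TX : Terms (Orb (Fin N))) (μ : Fin 2 → ℚ) (ν κhi hi κlo lo : ℚ)
    (TGs : List (Terms (Orb (Fin N)))) {m : Type*} [Fintype m] [DecidableEq m] {Λm : Matrix m m ℂ} (hΛm : Λm.PosSemidef)
    (O : m → FermionOp Λ') (hTG : termOp d TGs.flatten = gramForm Λm O) (EB : List (Terms β))
    {nS : ℕ} (γ : Fin nS → DihedralGroup 4) (hγS : ∀ l, γ l ∈ S) (wv : Fin nS → Site 2)
    (hsh : ∀ l, d4ShiftSet (γ l) (wv l) Λ ⊆ Λ') (g : Fin nS → β → Orb (Fin N))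
    (hg : ∀ l b, d (g l b) = Orb.embMap (PolySite.incl (hsh l)) (Orb.embMap (PolySite.d4Emb (γ l) (wv l) Λ) (dΛ b)))
    (SY : Fin nS → Terms β)
    (CW : Terms (Orb (Fin N))) (hcw : ∀ wc ∈ CW, chargeW wc.1 ≠ 0 ∨ spinChargeW sp wc.1 ≠ 0)
    (AV : List (Terms (Orb (Fin N))))
    -- the chain: slice groups, step count, accumulators (eval% literals), start, kernel facts
    (ns : List ℕ) (M : ℕ) (Cs : List SOSDual.EncPoly) (hC0 : Cs.getD 0 [] = [])
    (hchain : ChainOK Bkey M Cs (groupSlices (residTGslices TX μ ν o κhi hi κlo lo TE TGs TH f EB g SY CW AV) ns))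
    -- the ONE rational inequality on the last accumulator
    {q s n₀ : ℚ} (hs : s = (μ 0 + μ 1) / 2)
    (hq : q ≤ lowerConst (SOSDual.decPoly N (Cs.getD M [])) + (μ 0 + μ 1) * (n₀ / 2 - ν)) :
    SquareTTPrimeCorrAffineOrbitLowerRowN (tp : ℝ) (U : ℝ) q hi lo κhi κlo s n₀ S Λ' (termOp d TX) := by
  have hRsem : evalPoly d (SOSDual.decPoly N (Cs.getD M [])) =
      termOp d (residTG TX μ ν o κhi hi κlo lo TE TGs.flatten TH f EB g SY CW AV) := by
    rw [evalPoly_chain_nil hd hC0 hchain, flatten_groupSlices, flatten_residTGslices]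
  exact affineOrbitLowerRowN_of_residPolyG tp U hU hΛ h8 h0 hz h1 hmul d dΛ f hf sp hsp TH hH TE hE o ho TX μ ν κhi hi κlo lo
    TGs.flatten hΛm O hTG EB γ hγS wv hsh g hg SY CW hcw AV hRsem hs hq

/-- **STAGED KERNEL FORM, TWO-LEVEL GRAM: the symmetry-adapted instance** — Gram slices `gramTBslices K blocks` (PSD by construction,
no positivity test), every other datum as above; the per-certificate obligations are the per-step chain facts and the ONE decidable
inequality `q ≤ lowerConst (decPoly N C_M) + (μ 0 + μ 1)(n₀/2 − ν)`. [cite: WangEtAl2024, §III] [cite: JanssonChaykinKeil2008, §3] -/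
theorem affineOrbitLowerRowN_of_chainKernelCertTB
    (tp U : ℚ) (hU : 0 ≤ U)
    {Λ Λ' : Finset (Site 2)} (hΛ : Λ ⊆ Λ') (h8 : thicken Λ 1 ⊆ Λ')
    (h0 : thicken ({0} : Finset (Site 2)) 1 ⊆ Λ') (hz : (0 : Site 2) ∈ Λ')
    {S : Finset (DihedralGroup 4)} (h1 : (1 : DihedralGroup 4) ∈ S) (hmul : ∀ a ∈ S, ∀ b ∈ S, a * b ∈ S)
    -- letters
    (d : Orb (Fin N) → Orb (PolySite Λ')) (hd : Function.Injective d) (Bkey : ℕ)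
    (dΛ : β → Orb (PolySite Λ)) (f : β → Orb (Fin N)) (hf : ∀ b, d (f b) = Orb.embMap (PolySite.incl hΛ) (dΛ b))
    (sp : Orb (Fin N) → Fin 2) (hsp : ∀ a, (ofLex (d a)).2 = sp a)
    -- dictionaries
    (TH : Terms (Orb (Fin N))) (hH : termOp d TH = (hubbardTTPrimeFermionInteraction 1 tp U).localHamiltonian Λ')
    (TE : Terms (Orb (Fin N)))
    (hE : termOp d TE = fermionEmbed (PolySite.incl h0) ((hubbardTTPrimeFermionInteraction 1 tp U).meanEnergyObs 1))
    (o : Fin 2 → Orb (Fin N)) (ho : ∀ σ, d (o σ) = orb (PolySite.pt 0 hz) σ)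
    -- certificate data
    (TX : Terms (Orb (Fin N))) (μ : Fin 2 → ℚ) (ν κhi hi κlo lo : ℚ) (K : ℕ) (blocks : List (List (List ℤ × Terms (Orb (Fin N)))))
    (EB : List (Terms β))
    {nS : ℕ} (γ : Fin nS → DihedralGroup 4) (hγS : ∀ l, γ l ∈ S) (wv : Fin nS → Site 2)
    (hsh : ∀ l, d4ShiftSet (γ l) (wv l) Λ ⊆ Λ') (g : Fin nS → β → Orb (Fin N))
    (hg : ∀ l b, d (g l b) = Orb.embMap (PolySite.incl (hsh l)) (Orb.embMap (PolySite.d4Emb (γ l) (wv l) Λ) (dΛ b)))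
    (SY : Fin nS → Terms β)
    (CW : Terms (Orb (Fin N))) (hcw : ∀ wc ∈ CW, chargeW wc.1 ≠ 0 ∨ spinChargeW sp wc.1 ≠ 0)
    (AV : List (Terms (Orb (Fin N))))
    -- the chain
    (ns : List ℕ) (M : ℕ) (Cs : List SOSDual.EncPoly) (hC0 : Cs.getD 0 [] = [])
    (hchain : ChainOK Bkey M Cs
      (groupSlices (residTGslices TX μ ν o κhi hi κlo lo TE (gramTBslices K blocks) TH f EB g SY CW AV) ns))
    -- the ONE rational inequality on the last accumulator
    {q s n₀ : ℚ} (hs : s = (μ 0 + μ 1) / 2)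
    (hq : q ≤ lowerConst (SOSDual.decPoly N (Cs.getD M [])) + (μ 0 + μ 1) * (n₀ / 2 - ν)) :
    SquareTTPrimeCorrAffineOrbitLowerRowN (tp : ℝ) (U : ℝ) q hi lo κhi κlo s n₀ S Λ' (termOp d TX) := by
  have hTG : termOp d (gramTBslices K blocks).flatten = gramForm (gramTBCoef K blocks) (gramTBOp d blocks) := by
    rw [flatten_gramTBslices, termOp_gramTB_eq_gramForm]
  exact affineOrbitLowerRowN_of_chainKernelCertG tp U hU hΛ h8 h0 hz h1 hmul d hd Bkey dΛ f hf sp hsp TH hH TE hE o ho TX μ ν κhi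
    hi κlo lo (gramTBslices K blocks) (gramTBCoef_posSemidef K blocks) (gramTBOp d blocks) hTG EB γ hγS wv hsh g hg SY CW hcw AV
    ns M Cs hC0 hchain hs hq

end KernelChain

end CARPolyWindow

end Summit.Ventures.CertifiedManyBodySolver
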